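import Literature.MathematicalPhysics.QuantumLattice.HubbardTTPrimeThermalWindowCertificateTemperatureTransport
import Literature.MathematicalPhysics.QuantumLattice.TorusSectorGibbsFillingBoxWindow
import HarnessLib

/-!
# The FILLING leg of thermal-certificate transport: ONE `t–t'` thermal window certificate words every
# thermal torus limit at every density of a filling box `n ∈ [n₁, n₂]`; the four-parameter cell
# `[tp₁,tp₂] × [U₁,U₂] × [β₁,β₂] × [n₁,n₂]`

Family `hubbard` (topic `MathematicalPhysics/QuantumLattice`). Companion of
`HubbardTTPrimeThermalWindowCertificateSymm` (the reader of a full-symmetry thermal window certificate in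
torus limits of the canonical `S^z = 0` sector Gibbs states, densities evaluated:
`c − Σₖ‖aₖ‖ + (Σ_σ μ_σ)(n/2 − ν) + κ(u − e^{tt'U}(ω)) ≤ Re ω_{Λ'}(Xw)`), of
`HubbardTTPrimeThermalWindowCertificateAnchorTransport` / `…TemperatureTransport` (the `(t', U)` and `β`
legs: one certificate at an anchor words the cell `[tp₁,tp₂] × [U₁,U₂] × [β₁,β₂]`), and the thermal twin of
`HubbardNNNHoppingTorusLimitCorrelatorFillingBox` (`T = 0`). Written for the material-oracle pipeline
(downfold ↦ certifier, cell `pub/hubbard-downfold`): the downfold hands over a FILLING BOX, not a density,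
and the phase map asks for words at `T > 0`.

Two observations make a thermal certificate a filling-BOX certificate, exactly as at `T = 0`:

* the operator identity `hcert` of the reader is density-free — `n` enters only through the CLASS of
  states (`IsTorusLimitOfMixture (sectorGibbsCount n) (sectorGibbsWeightTT' β t t' U n ·) …`), through the
  evaluated density rows `(Σ_σ μ_σ)(n/2 − ν)`, and through the constants a writer books against `n`
  (the cap `u` of the energy row `κ(u·1 − Γ E_Φ)`, the floors of cut rows `Gₑ`);
* the evaluated bound is AFFINE in `n`, so on a box it is at least the smaller of its two endpoint values,
  while the energy row is booked ONCE for the whole box by a `T = 0` box cap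
  `e(t,t',U,x) ≤ hi ∀ x ∈ [n₁,n₂]` (`HubbardFillingBoxEnergyBounds`) plus the entropy re-booking `S/β⋆`,
  `2H_b(x/2) ≤ S` on the box, valid at every `β ≥ β⋆`
  (`IsTorusLimitOfMixture.meanEnergy_le_of_fillingBox_cap_at_le_beta`, `TorusSectorGibbsFillingBoxWindow`).

Contents (everything PROVED; no definition, no named fact, no numerical input):

* §1 `IsTorusLimitOfMixture.re_expect_ge_of_thermal_certificate_symm_TT'_of_fillingBox` — the reader on a
  filling box, energy term kept: for every `n ∈ [n₁, n₂]` (`0 ≤ n₁`, `n₂ ≤ 2`) and every thermal torus limit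
  `ω` at `(β, t, t', U, n)`,
  `c − Σₖ‖aₖ‖ + min((Σμ)(n₁/2 − ν), (Σμ)(n₂/2 − ν)) + κ(u − e(ω)) ≤ Re ω_{Λ'}(Xw)`.
* §2 `…_of_fillingBox_cap` — the energy row DISCHARGED on the box × the low-temperature half-line
  `β ≥ β⋆`: `κ ≥ 0`, `U ≥ 0`, `n₂ < 2`, box cap `hi`, entropy constant `S`, ONE booking `hi + S/β⋆ ≤ u` ⇒
  `c − Σₖ‖aₖ‖ + min(…) ≤ Re ω_{Λ'}(Xw)`; `…_of_fillingBox_cap_log_four` (`S = 2 log 2`); and the energy-cap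
  corollary `…meanEnergy_le_of_thermal_certificate_symm_TT'_of_fillingBox` (objective `−Γ E_Φ`, `κ = 0`):
  `e(ω) ≤ Σₖ‖aₖ‖ − c − min(…)` uniformly on the box.
* §3 `…_transport₃_on_cell_of_fillingBox` — the FOUR-PARAMETER CELL: one eom/EEB-class thermal certificate
  issued at an anchor `(t'_A, U_A, β_A)` words every thermal torus limit on
  `[tp₁,tp₂] × [U₁,U₂] × [β₁,β₂] × [n₁,n₂]` (`U₁ ≥ 0`, `β₁ > 0`, `0 ≤ n₁`, `n₂ < 2`): the conclusion of
  `…_transport₃_on_cell` with its three `n`-dependent constants replaced by box constants — the anchor energy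
  `e(t,t'_A,U_A,n)` by a box cap `hiA` at the ANCHOR couplings, the entropy re-booking `2H_b(n/2)` by `S`,
  the double-occupancy width `n/2 − max(0,n−1)` by `min(n₂/2, 1 − n₁/2)` — and the density term by its
  endpoint minimum. This is the full single-band box `(t'/t, U/t, n) × T`-cell of the downfold at `t ≡ 1`
  (the scale `t_eV` rides on `TorusSectorGibbsScaleCovariance` / `OneBandBoxThermal`).

HONEST SCOPE: transport lemmas only — no number, no certificate, no claim on the Hubbard model's phases; the
torus-limit thermal convention, the charged-generator caveat of the reader (EEB generators conserve the local
`N`, `S^z`) and the extra-row bookkeeping (generic nulls `N_z` and extra/target rows `Gₑ` are hypotheses BY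
NAME, to be discharged per state — a cut row needs a box FLOOR) are unchanged. STATE-DEPENDENT data do not
move in `n` (no continuity of thermal states in the density is claimed): what transports is the certificate,
because its identity does not mention `n`. WHAT THIS IS NOT: a certificate, a phase sentence, or a number.

## Mathlib / tree search

REUSED: `IsTorusLimitOfMixture.re_expect_ge_of_thermal_certificate_symm_TT'_of_sectorGibbs`
(`HubbardTTPrimeThermalWindowCertificateSymm`),
`IsTorusLimitOfMixture.re_expect_ge_of_thermal_certificate_symm_TT'_transport₃_on_cell`
(`HubbardTTPrimeThermalWindowCertificateTemperatureTransport`),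
`IsTorusLimitOfMixture.meanEnergy_le_of_fillingBox_cap_at_le_beta` (`TorusSectorGibbsFillingBoxWindow`),
`InfVolFermionState.re_expect_fermionEmbed_meanEnergyObs`, Mathlib `Real.binEntropy_le_log_two`.
`lean search 'fillingBox'`: the `T = 0` correlator box reader
`IsTorusLimitOf.re_expect_ge_of_window_certificate_TT'_ineq_of_fillingBox` and the thermal energy windows of
`TorusSectorGibbsFillingBoxWindow` / `TorusSectorGibbsFillingBoxFreeEnergy`; no thermal CERTIFICATE box reader
(2026-08-27). presearch (corpus hybrid «bootstrap relaxation validity over a density interval», galaxy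
«filling box|density interval certificate», star all): none beyond the sources below.

## References

* H. Fawzi, O. Fawzi, S. O. Scalet (2024), Thm. 3.6 (EEB-constrained relaxations bound every KMS state;
  the data enter the dual linearly). [cite: FawziFawziScalet2024, Thm. 3.6]
* J. Wang et al., PRX 14 (2024) 031006, §III (energy half-spaces enter only as constraints, so any window
  valid on the box may be booked). [cite: WangEtAl2024, §III]
* D. Ruelle, *Statistical Mechanics: Rigorous Results* (1969), §3.3–§3.4 (convexity of the energy density
  in the density — the source of box windows). [cite: Ruelle1969, §3.3]
* R. B. Israel, *Convexity in the theory of lattice gases* (1979), Lemma II.3.1 (entropy bound on the mean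
  energy of equilibrium states). [cite: Israel1979, Lemma II.3.1]
-/

noncomputable section

namespace Literature.MathematicalPhysics.QuantumLattice

open Matrix Finset HubbardWave0 Literature.Probability.LatticeModels ThermodynamicLimit
open Literature.MathematicalPhysics.QuantumManyBody.StateRelaxation
open _root_.Filter
open scoped _root_.Topology ComplexOrder BigOperators

/-! ### §0 Endpoint arithmetic -/

/-- An affine function of the density on `[n₁, n₂]` is at least the smaller endpoint value:
`min (M(n₁/2 − ν)) (M(n₂/2 − ν)) ≤ M(n/2 − ν)` for `n₁ ≤ n ≤ n₂`. [folklore] -/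
private theorem min_mul_endpoints_le {M ν n₁ n₂ n : ℝ} (h₁ : n₁ ≤ n) (h₂ : n ≤ n₂) :
    min (M * (n₁ / 2 - ν)) (M * (n₂ / 2 - ν)) ≤ M * (n / 2 - ν) := by
  rcases le_total 0 M with hM | hM
  · exact (min_le_left _ _).trans (by nlinarith)
  · exact (min_le_right _ _).trans (by nlinarith)

/-- The double-occupancy width `n/2 − max(0, n − 1)` on a filling box is at most `min (n₂/2) (1 − n₁/2)`.
[folklore] -/
private theorem half_sub_max_le_of_mem_Icc {n₁ n₂ n : ℝ} (h₁ : n₁ ≤ n) (h₂ : n ≤ n₂) :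
    n / 2 - max 0 (n - 1) ≤ min (n₂ / 2) (1 - n₁ / 2) := by
  refine le_min ?_ ?_
  · linarith [le_max_left (0 : ℝ) (n - 1)]
  · linarith [le_max_right (0 : ℝ) (n - 1)]

/-- Everywhere on `[0, 2]`: `2H_b(x/2) ≤ 2 log 2`. [folklore] -/
private theorem two_mul_binEntropy_half_le_two_log_two (x : ℝ) :
    2 * Real.binEntropy (x / 2) ≤ 2 * Real.log 2 := by
  have := Real.binEntropy_le_log_two (p := x / 2)
  linarith

namespace InfVolFermionState

/-! ### §1 The thermal reader on a filling box (energy term kept) -/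

/-- **ONE full-symmetry thermal window certificate bounds every thermal torus limit at every density of a
filling box.** Data as in `re_expect_ge_of_thermal_certificate_symm_TT'_of_sectorGibbs` (the identity `hcert`
does not mention `n`). For every `n ∈ [n₁, n₂]` (`0 ≤ n₁`, `n₂ ≤ 2`) and every torus limit `ω` of the canonical
`S^z = 0` sector Gibbs states of `hubbardTorusTT' · t t' U` at inverse temperature `β` and filling `n`
(`Ls → ∞`; generic nulls `N_z` killed and extra rows `Gₑ` nonnegative in `ω`, by name):
`c − Σₖ‖aₖ‖ + min((Σ_σ μ_σ)(n₁/2 − ν), (Σ_σ μ_σ)(n₂/2 − ν)) + κ(u − e^{tt'U}(ω)) ≤ Re ω_{Λ'}(Xw)` — one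
certificate, two endpoint evaluations, the whole box. [cite: FawziFawziScalet2024, Thm. 3.6]
[cite: WangEtAl2024, §III] -/
theorem IsTorusLimitOfMixture.re_expect_ge_of_thermal_certificate_symm_TT'_of_fillingBox
    (t t' U : ℝ) {n₁ n₂ : ℝ} (hn₁ : 0 ≤ n₁) (hn₂ : n₂ ≤ 2) (β : ℝ)
    {n : ℝ} (hn : n ∈ Set.Icc n₁ n₂) {ω : InfVolFermionState 2} {Ls : ℕ → ℕ}
    (h : ω.IsTorusLimitOfMixture (sectorGibbsCount n) (fun L => sectorGibbsWeightTT' β t t' U n L)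
      (fun L => sectorGibbsVectorTT' t t' U n L) Ls)
    (hLs : Tendsto Ls atTop atTop)
    {Λ Λ' : Finset (Site 2)} (hΛ : Λ ⊆ Λ') (h8 : thicken Λ 1 ⊆ Λ')
    (h0 : thicken ({0} : Finset (Site 2)) 1 ⊆ Λ') (hz : (0 : Site 2) ∈ Λ')
    (Xw : FermionOp Λ') (κ u : ℝ) (μ : Fin 2 → ℝ) (ν : ℝ)
    {m : Type*} [Fintype m] [DecidableEq m] {Λm : Matrix m m ℂ} (hΛm : Λm.PosSemidef)
    (O : m → FermionOp Λ')
    {κ' : Type*} (s : Finset κ') (B : κ' → FermionOp Λ)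
    {ι : Type*} (tt : Finset ι) (γ : ι → DihedralGroup 4) (wv : ι → Site 2)
    (hsh : ∀ l, d4ShiftSet (γ l) (wv l) Λ ⊆ Λ') (Y : ι → FermionOp Λ)
    {ρ : Type*} (uu : Finset ρ) (b : ρ → ℂ) (cw : ρ → List (Orb (PolySite Λ') × Bool))
    (hcw : ∀ j ∈ uu, ladderCharge (cw j) ≠ 0 ∨ ladderSpinCharge (cw j) ≠ 0)
    {φ : Type*} (ff : Finset φ) (Yf : φ → FermionOp Λ')
    {ζ : Type*} (zz : Finset ζ) (Nz : ζ → FermionOp Λ') (hnull : ∀ z ∈ zz, ω.expect Λ' (Nz z) = 0)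
    {θ : Type*} (rr : Finset θ) (lam : θ → ℝ) (hlam : ∀ r ∈ rr, 0 ≤ lam r) (A : θ → FermionOp Λ)
    (hAN : ∀ r ∈ rr, Commute (A r) (totalNumber : FermionOp Λ))
    (hAS : ∀ r ∈ rr, Commute (A r) (HubbardWave0.spinZ : FermionOp Λ))
    (sv qv : θ → ℝ) (hq : ∀ r ∈ rr, Real.exp (sv r - 1) ≤ qv r)
    {η : Type*} (gg : Finset η) (kap : η → ℝ) (hkap : ∀ e ∈ gg, 0 ≤ kap e) (G : η → FermionOp Λ')
    (hG : ∀ e ∈ gg, 0 ≤ (ω.expect Λ' (G e)).re)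
    {δ : Type*} (ah : Finset δ) (dc : δ → ℝ) (V : δ → FermionOp Λ')
    {κ'' : Type*} (w : Finset κ'') (a : κ'' → ℂ) (word : κ'' → List (Orb (PolySite Λ') × Bool)) {c : ℝ}
    (hcert : Xw - (c : ℂ) • (1 : FermionOp Λ') -
        ∑ σ : Fin 2, ((μ σ : ℝ) : ℂ) • (nAt 0 hz σ - ((ν : ℝ) : ℂ) • (1 : FermionOp Λ')) -
        ((κ : ℝ) : ℂ) • (((u : ℝ) : ℂ) • (1 : FermionOp Λ') -
          fermionEmbed (PolySite.incl h0) ((hubbardTTPrimeFermionInteraction t t' U).meanEnergyObs 1)) =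
      gramForm Λm O +
        (∑ k ∈ s, ((hubbardTTPrimeFermionInteraction t t' U).localHamiltonian Λ' * fermionEmbed (PolySite.incl hΛ) (B k) -
            fermionEmbed (PolySite.incl hΛ) (B k) * (hubbardTTPrimeFermionInteraction t t' U).localHamiltonian Λ') +
          ∑ l ∈ tt, (fermionEmbed (PolySite.incl (hsh l)) (fermionEmbed (PolySite.d4Emb (γ l) (wv l) Λ) (Y l)) -
            fermionEmbed (PolySite.incl hΛ) (Y l)) +
          ∑ j ∈ uu, b j • ladderWord (cw j) +
          ∑ f ∈ ff, (relabel (Orb.spinSwap : Orb (PolySite Λ') ≃ Orb (PolySite Λ')) (Yf f) - Yf f) +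
          ∑ z ∈ zz, Nz z) +
        (∑ r ∈ rr, ((lam r : ℝ) : ℂ) •
            (((β : ℝ) : ℂ) • ((fermionEmbed (PolySite.incl hΛ) (A r))ᴴ *
                ((hubbardTTPrimeFermionInteraction t t' U).localHamiltonian Λ' * fermionEmbed (PolySite.incl hΛ) (A r) -
                  fermionEmbed (PolySite.incl hΛ) (A r) * (hubbardTTPrimeFermionInteraction t t' U).localHamiltonian Λ')) -
              ((sv r : ℝ) : ℂ) • ((fermionEmbed (PolySite.incl hΛ) (A r))ᴴ * fermionEmbed (PolySite.incl hΛ) (A r)) +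
              ((qv r : ℝ) : ℂ) • (fermionEmbed (PolySite.incl hΛ) (A r) * (fermionEmbed (PolySite.incl hΛ) (A r))ᴴ)) +
          ∑ e ∈ gg, ((kap e : ℝ) : ℂ) • G e) +
        (∑ m' ∈ ah, ((dc m' : ℝ) : ℂ) • ((V m')ᴴ - V m') + ∑ k ∈ w, a k • ladderWord (word k))) :
    c - ∑ k ∈ w, ‖a k‖ + min ((∑ σ : Fin 2, μ σ) * (n₁ / 2 - ν)) ((∑ σ : Fin 2, μ σ) * (n₂ / 2 - ν)) +
        κ * (u - ω.meanEnergy (hubbardTTPrimeFermionInteraction t t' U) 1) ≤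
      (ω.expect Λ' Xw).re := by
  have hmain := h.re_expect_ge_of_thermal_certificate_symm_TT'_of_sectorGibbs t t' U (hn₁.trans hn.1)
    (hn.2.trans hn₂) β hLs hΛ h8 h0 hz Xw κ u μ ν hΛm O s B tt γ wv hsh Y uu b cw hcw ff Yf zz Nz hnull rr
    lam hlam A hAN hAS sv qv hq gg kap hkap G hG ah dc V w a word hcert
  have hmin := min_mul_endpoints_le (M := ∑ σ : Fin 2, μ σ) (ν := ν) hn.1 hn.2
  linarith

/-! ### §2 The energy row discharged on the box × the low-temperature half-line -/

/-- **The filling-box reader with the energy row booked once.** As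
`re_expect_ge_of_thermal_certificate_symm_TT'_of_fillingBox` with `κ ≥ 0`, `U ≥ 0`, `0 ≤ n₁`, `n₂ < 2`, a
`T = 0` box cap `e(t,t',U,x) ≤ hi` and an entropy constant `2H_b(x/2) ≤ S` for all `x ∈ [n₁, n₂]`
(`HubbardFillingBoxEnergyBounds`, `TorusSectorGibbsFillingBoxWindow`), and ONE booking `hi + S/β⋆ ≤ u` at a
`β⋆ > 0` below the state's inverse temperature `β ≥ β⋆`. Then for every `n ∈ [n₁, n₂]` and every thermal
torus limit `ω` at `(β, t, t', U, n)`: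
`c − Σₖ‖aₖ‖ + min((Σ_σ μ_σ)(n₁/2 − ν), (Σ_σ μ_σ)(n₂/2 − ν)) ≤ Re ω_{Λ'}(Xw)` — the energy term
`κ(u − e(ω)) ≥ 0` is dropped by `meanEnergy_le_of_fillingBox_cap_at_le_beta`.
[cite: FawziFawziScalet2024, Thm. 3.6] [cite: Israel1979, Lemma II.3.1] -/
theorem IsTorusLimitOfMixture.re_expect_ge_of_thermal_certificate_symm_TT'_of_fillingBox_cap
    (t t' : ℝ) {U : ℝ} (hU : 0 ≤ U) {n₁ n₂ : ℝ} (hn₁ : 0 ≤ n₁) (hn₂ : n₂ < 2)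
    {βs β : ℝ} (hβs : 0 < βs) (hle : βs ≤ β) {hi S : ℝ}
    (hhi : ∀ x ∈ Set.Icc n₁ n₂, energyDensityTT' t t' U x ≤ hi)
    (hS : ∀ x ∈ Set.Icc n₁ n₂, 2 * Real.binEntropy (x / 2) ≤ S)
    {κ u : ℝ} (hκ : 0 ≤ κ) (hu : hi + S / βs ≤ u)
    {n : ℝ} (hn : n ∈ Set.Icc n₁ n₂) {ω : InfVolFermionState 2} {Ls : ℕ → ℕ}
    (h : ω.IsTorusLimitOfMixture (sectorGibbsCount n) (fun L => sectorGibbsWeightTT' β t t' U n L)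
      (fun L => sectorGibbsVectorTT' t t' U n L) Ls)
    (hLs : Tendsto Ls atTop atTop)
    {Λ Λ' : Finset (Site 2)} (hΛ : Λ ⊆ Λ') (h8 : thicken Λ 1 ⊆ Λ')
    (h0 : thicken ({0} : Finset (Site 2)) 1 ⊆ Λ') (hz : (0 : Site 2) ∈ Λ')
    (Xw : FermionOp Λ') (μ : Fin 2 → ℝ) (ν : ℝ)
    {m : Type*} [Fintype m] [DecidableEq m] {Λm : Matrix m m ℂ} (hΛm : Λm.PosSemidef)
    (O : m → FermionOp Λ')
    {κ' : Type*} (s : Finset κ') (B : κ' → FermionOp Λ)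
    {ι : Type*} (tt : Finset ι) (γ : ι → DihedralGroup 4) (wv : ι → Site 2)
    (hsh : ∀ l, d4ShiftSet (γ l) (wv l) Λ ⊆ Λ') (Y : ι → FermionOp Λ)
    {ρ : Type*} (uu : Finset ρ) (b : ρ → ℂ) (cw : ρ → List (Orb (PolySite Λ') × Bool))
    (hcw : ∀ j ∈ uu, ladderCharge (cw j) ≠ 0 ∨ ladderSpinCharge (cw j) ≠ 0)
    {φ : Type*} (ff : Finset φ) (Yf : φ → FermionOp Λ')
    {ζ : Type*} (zz : Finset ζ) (Nz : ζ → FermionOp Λ') (hnull : ∀ z ∈ zz, ω.expect Λ' (Nz z) = 0)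
    {θ : Type*} (rr : Finset θ) (lam : θ → ℝ) (hlam : ∀ r ∈ rr, 0 ≤ lam r) (A : θ → FermionOp Λ)
    (hAN : ∀ r ∈ rr, Commute (A r) (totalNumber : FermionOp Λ))
    (hAS : ∀ r ∈ rr, Commute (A r) (HubbardWave0.spinZ : FermionOp Λ))
    (sv qv : θ → ℝ) (hq : ∀ r ∈ rr, Real.exp (sv r - 1) ≤ qv r)
    {η : Type*} (gg : Finset η) (kap : η → ℝ) (hkap : ∀ e ∈ gg, 0 ≤ kap e) (G : η → FermionOp Λ')
    (hG : ∀ e ∈ gg, 0 ≤ (ω.expect Λ' (G e)).re)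
    {δ : Type*} (ah : Finset δ) (dc : δ → ℝ) (V : δ → FermionOp Λ')
    {κ'' : Type*} (w : Finset κ'') (a : κ'' → ℂ) (word : κ'' → List (Orb (PolySite Λ') × Bool)) {c : ℝ}
    (hcert : Xw - (c : ℂ) • (1 : FermionOp Λ') -
        ∑ σ : Fin 2, ((μ σ : ℝ) : ℂ) • (nAt 0 hz σ - ((ν : ℝ) : ℂ) • (1 : FermionOp Λ')) -
        ((κ : ℝ) : ℂ) • (((u : ℝ) : ℂ) • (1 : FermionOp Λ') -
          fermionEmbed (PolySite.incl h0) ((hubbardTTPrimeFermionInteraction t t' U).meanEnergyObs 1)) =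
      gramForm Λm O +
        (∑ k ∈ s, ((hubbardTTPrimeFermionInteraction t t' U).localHamiltonian Λ' * fermionEmbed (PolySite.incl hΛ) (B k) -
            fermionEmbed (PolySite.incl hΛ) (B k) * (hubbardTTPrimeFermionInteraction t t' U).localHamiltonian Λ') +
          ∑ l ∈ tt, (fermionEmbed (PolySite.incl (hsh l)) (fermionEmbed (PolySite.d4Emb (γ l) (wv l) Λ) (Y l)) -
            fermionEmbed (PolySite.incl hΛ) (Y l)) +
          ∑ j ∈ uu, b j • ladderWord (cw j) +
          ∑ f ∈ ff, (relabel (Orb.spinSwap : Orb (PolySite Λ') ≃ Orb (PolySite Λ')) (Yf f) - Yf f) +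
          ∑ z ∈ zz, Nz z) +
        (∑ r ∈ rr, ((lam r : ℝ) : ℂ) •
            (((β : ℝ) : ℂ) • ((fermionEmbed (PolySite.incl hΛ) (A r))ᴴ *
                ((hubbardTTPrimeFermionInteraction t t' U).localHamiltonian Λ' * fermionEmbed (PolySite.incl hΛ) (A r) -
                  fermionEmbed (PolySite.incl hΛ) (A r) * (hubbardTTPrimeFermionInteraction t t' U).localHamiltonian Λ')) -
              ((sv r : ℝ) : ℂ) • ((fermionEmbed (PolySite.incl hΛ) (A r))ᴴ * fermionEmbed (PolySite.incl hΛ) (A r)) +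
              ((qv r : ℝ) : ℂ) • (fermionEmbed (PolySite.incl hΛ) (A r) * (fermionEmbed (PolySite.incl hΛ) (A r))ᴴ)) +
          ∑ e ∈ gg, ((kap e : ℝ) : ℂ) • G e) +
        (∑ m' ∈ ah, ((dc m' : ℝ) : ℂ) • ((V m')ᴴ - V m') + ∑ k ∈ w, a k • ladderWord (word k))) :
    c - ∑ k ∈ w, ‖a k‖ + min ((∑ σ : Fin 2, μ σ) * (n₁ / 2 - ν)) ((∑ σ : Fin 2, μ σ) * (n₂ / 2 - ν)) ≤
      (ω.expect Λ' Xw).re := by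
  have hmain := h.re_expect_ge_of_thermal_certificate_symm_TT'_of_fillingBox t t' U hn₁ hn₂.le β hn hLs hΛ
    h8 h0 hz Xw κ u μ ν hΛm O s B tt γ wv hsh Y uu b cw hcw ff Yf zz Nz hnull rr lam hlam A hAN hAS sv qv hq
    gg kap hkap G hG ah dc V w a word hcert
  have hcap := h.meanEnergy_le_of_fillingBox_cap_at_le_beta t t' hU hn₁ hn₂ hβs hle hhi hS hu hn hLs
  have hterm : 0 ≤ κ * (u - ω.meanEnergy (hubbardTTPrimeFermionInteraction t t' U) 1) :=
    mul_nonneg hκ (sub_nonneg.2 hcap)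
  linarith

/-- **Any filling box, entropy booked as `log 4`**: as `…_of_fillingBox_cap` with `S = 2 log 2`, i.e. the
booking `hi + (2 log 2)/β⋆ ≤ u`. [cite: FawziFawziScalet2024, Thm. 3.6] [cite: Israel1979, Lemma II.3.1] -/
theorem IsTorusLimitOfMixture.re_expect_ge_of_thermal_certificate_symm_TT'_of_fillingBox_cap_log_four
    (t t' : ℝ) {U : ℝ} (hU : 0 ≤ U) {n₁ n₂ : ℝ} (hn₁ : 0 ≤ n₁) (hn₂ : n₂ < 2)
    {βs β : ℝ} (hβs : 0 < βs) (hle : βs ≤ β) {hi : ℝ}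
    (hhi : ∀ x ∈ Set.Icc n₁ n₂, energyDensityTT' t t' U x ≤ hi)
    {κ u : ℝ} (hκ : 0 ≤ κ) (hu : hi + 2 * Real.log 2 / βs ≤ u)
    {n : ℝ} (hn : n ∈ Set.Icc n₁ n₂) {ω : InfVolFermionState 2} {Ls : ℕ → ℕ}
    (h : ω.IsTorusLimitOfMixture (sectorGibbsCount n) (fun L => sectorGibbsWeightTT' β t t' U n L)
      (fun L => sectorGibbsVectorTT' t t' U n L) Ls)
    (hLs : Tendsto Ls atTop atTop)
    {Λ Λ' : Finset (Site 2)} (hΛ : Λ ⊆ Λ') (h8 : thicken Λ 1 ⊆ Λ')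
    (h0 : thicken ({0} : Finset (Site 2)) 1 ⊆ Λ') (hz : (0 : Site 2) ∈ Λ')
    (Xw : FermionOp Λ') (μ : Fin 2 → ℝ) (ν : ℝ)
    {m : Type*} [Fintype m] [DecidableEq m] {Λm : Matrix m m ℂ} (hΛm : Λm.PosSemidef)
    (O : m → FermionOp Λ')
    {κ' : Type*} (s : Finset κ') (B : κ' → FermionOp Λ)
    {ι : Type*} (tt : Finset ι) (γ : ι → DihedralGroup 4) (wv : ι → Site 2)
    (hsh : ∀ l, d4ShiftSet (γ l) (wv l) Λ ⊆ Λ') (Y : ι → FermionOp Λ)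
    {ρ : Type*} (uu : Finset ρ) (b : ρ → ℂ) (cw : ρ → List (Orb (PolySite Λ') × Bool))
    (hcw : ∀ j ∈ uu, ladderCharge (cw j) ≠ 0 ∨ ladderSpinCharge (cw j) ≠ 0)
    {φ : Type*} (ff : Finset φ) (Yf : φ → FermionOp Λ')
    {ζ : Type*} (zz : Finset ζ) (Nz : ζ → FermionOp Λ') (hnull : ∀ z ∈ zz, ω.expect Λ' (Nz z) = 0)
    {θ : Type*} (rr : Finset θ) (lam : θ → ℝ) (hlam : ∀ r ∈ rr, 0 ≤ lam r) (A : θ → FermionOp Λ)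
    (hAN : ∀ r ∈ rr, Commute (A r) (totalNumber : FermionOp Λ))
    (hAS : ∀ r ∈ rr, Commute (A r) (HubbardWave0.spinZ : FermionOp Λ))
    (sv qv : θ → ℝ) (hq : ∀ r ∈ rr, Real.exp (sv r - 1) ≤ qv r)
    {η : Type*} (gg : Finset η) (kap : η → ℝ) (hkap : ∀ e ∈ gg, 0 ≤ kap e) (G : η → FermionOp Λ')
    (hG : ∀ e ∈ gg, 0 ≤ (ω.expect Λ' (G e)).re)
    {δ : Type*} (ah : Finset δ) (dc : δ → ℝ) (V : δ → FermionOp Λ')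
    {κ'' : Type*} (w : Finset κ'') (a : κ'' → ℂ) (word : κ'' → List (Orb (PolySite Λ') × Bool)) {c : ℝ}
    (hcert : Xw - (c : ℂ) • (1 : FermionOp Λ') -
        ∑ σ : Fin 2, ((μ σ : ℝ) : ℂ) • (nAt 0 hz σ - ((ν : ℝ) : ℂ) • (1 : FermionOp Λ')) -
        ((κ : ℝ) : ℂ) • (((u : ℝ) : ℂ) • (1 : FermionOp Λ') -
          fermionEmbed (PolySite.incl h0) ((hubbardTTPrimeFermionInteraction t t' U).meanEnergyObs 1)) =
      gramForm Λm O +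
        (∑ k ∈ s, ((hubbardTTPrimeFermionInteraction t t' U).localHamiltonian Λ' * fermionEmbed (PolySite.incl hΛ) (B k) -
            fermionEmbed (PolySite.incl hΛ) (B k) * (hubbardTTPrimeFermionInteraction t t' U).localHamiltonian Λ') +
          ∑ l ∈ tt, (fermionEmbed (PolySite.incl (hsh l)) (fermionEmbed (PolySite.d4Emb (γ l) (wv l) Λ) (Y l)) -
            fermionEmbed (PolySite.incl hΛ) (Y l)) +
          ∑ j ∈ uu, b j • ladderWord (cw j) +
          ∑ f ∈ ff, (relabel (Orb.spinSwap : Orb (PolySite Λ') ≃ Orb (PolySite Λ')) (Yf f) - Yf f) +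
          ∑ z ∈ zz, Nz z) +
        (∑ r ∈ rr, ((lam r : ℝ) : ℂ) •
            (((β : ℝ) : ℂ) • ((fermionEmbed (PolySite.incl hΛ) (A r))ᴴ *
                ((hubbardTTPrimeFermionInteraction t t' U).localHamiltonian Λ' * fermionEmbed (PolySite.incl hΛ) (A r) -
                  fermionEmbed (PolySite.incl hΛ) (A r) * (hubbardTTPrimeFermionInteraction t t' U).localHamiltonian Λ')) -
              ((sv r : ℝ) : ℂ) • ((fermionEmbed (PolySite.incl hΛ) (A r))ᴴ * fermionEmbed (PolySite.incl hΛ) (A r)) +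
              ((qv r : ℝ) : ℂ) • (fermionEmbed (PolySite.incl hΛ) (A r) * (fermionEmbed (PolySite.incl hΛ) (A r))ᴴ)) +
          ∑ e ∈ gg, ((kap e : ℝ) : ℂ) • G e) +
        (∑ m' ∈ ah, ((dc m' : ℝ) : ℂ) • ((V m')ᴴ - V m') + ∑ k ∈ w, a k • ladderWord (word k))) :
    c - ∑ k ∈ w, ‖a k‖ + min ((∑ σ : Fin 2, μ σ) * (n₁ / 2 - ν)) ((∑ σ : Fin 2, μ σ) * (n₂ / 2 - ν)) ≤
      (ω.expect Λ' Xw).re :=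
  h.re_expect_ge_of_thermal_certificate_symm_TT'_of_fillingBox_cap t t' hU hn₁ hn₂ hβs hle hhi
    (fun x _ => two_mul_binEntropy_half_le_two_log_two x) hκ hu hn hLs hΛ h8 h0 hz Xw μ ν hΛm O s B tt γ
    wv hsh Y uu b cw hcw ff Yf zz Nz hnull rr lam hlam A hAN hAS sv qv hq gg kap hkap G hG ah dc V w a word
    hcert

/-- **The thermal energy cap of a `κ = 0` certificate on a filling box.** Objective `Xw = −Γ E^{tt'U}_Φ`,
no energy row (`κ = 0`), density multipliers allowed: for every `n ∈ [n₁, n₂]` (`0 ≤ n₁`, `n₂ ≤ 2`) and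
every thermal torus limit `ω` at `(β, t, t', U, n)`,
`e^{tt'U}(ω) ≤ Σₖ‖aₖ‖ − c − min((Σ_σ μ_σ)(n₁/2 − ν), (Σ_σ μ_σ)(n₂/2 − ν))` — with `μ = 0` the cap is
UNIFORM on the box (nothing in it depends on `n`). [cite: FawziFawziScalet2024, Thm. 3.6] -/
theorem IsTorusLimitOfMixture.meanEnergy_le_of_thermal_certificate_symm_TT'_of_fillingBox
    (t t' U : ℝ) {n₁ n₂ : ℝ} (hn₁ : 0 ≤ n₁) (hn₂ : n₂ ≤ 2) (β : ℝ)
    {n : ℝ} (hn : n ∈ Set.Icc n₁ n₂) {ω : InfVolFermionState 2} {Ls : ℕ → ℕ}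
    (h : ω.IsTorusLimitOfMixture (sectorGibbsCount n) (fun L => sectorGibbsWeightTT' β t t' U n L)
      (fun L => sectorGibbsVectorTT' t t' U n L) Ls)
    (hLs : Tendsto Ls atTop atTop)
    {Λ Λ' : Finset (Site 2)} (hΛ : Λ ⊆ Λ') (h8 : thicken Λ 1 ⊆ Λ')
    (h0 : thicken ({0} : Finset (Site 2)) 1 ⊆ Λ') (hz : (0 : Site 2) ∈ Λ')
    (μ : Fin 2 → ℝ) (ν : ℝ)
    {m : Type*} [Fintype m] [DecidableEq m] {Λm : Matrix m m ℂ} (hΛm : Λm.PosSemidef)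
    (O : m → FermionOp Λ')
    {κ' : Type*} (s : Finset κ') (B : κ' → FermionOp Λ)
    {ι : Type*} (tt : Finset ι) (γ : ι → DihedralGroup 4) (wv : ι → Site 2)
    (hsh : ∀ l, d4ShiftSet (γ l) (wv l) Λ ⊆ Λ') (Y : ι → FermionOp Λ)
    {ρ : Type*} (uu : Finset ρ) (b : ρ → ℂ) (cw : ρ → List (Orb (PolySite Λ') × Bool))
    (hcw : ∀ j ∈ uu, ladderCharge (cw j) ≠ 0 ∨ ladderSpinCharge (cw j) ≠ 0)
    {φ : Type*} (ff : Finset φ) (Yf : φ → FermionOp Λ')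
    {ζ : Type*} (zz : Finset ζ) (Nz : ζ → FermionOp Λ') (hnull : ∀ z ∈ zz, ω.expect Λ' (Nz z) = 0)
    {θ : Type*} (rr : Finset θ) (lam : θ → ℝ) (hlam : ∀ r ∈ rr, 0 ≤ lam r) (A : θ → FermionOp Λ)
    (hAN : ∀ r ∈ rr, Commute (A r) (totalNumber : FermionOp Λ))
    (hAS : ∀ r ∈ rr, Commute (A r) (HubbardWave0.spinZ : FermionOp Λ))
    (sv qv : θ → ℝ) (hq : ∀ r ∈ rr, Real.exp (sv r - 1) ≤ qv r)
    {η : Type*} (gg : Finset η) (kap : η → ℝ) (hkap : ∀ e ∈ gg, 0 ≤ kap e) (G : η → FermionOp Λ')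
    (hG : ∀ e ∈ gg, 0 ≤ (ω.expect Λ' (G e)).re)
    {δ : Type*} (ah : Finset δ) (dc : δ → ℝ) (V : δ → FermionOp Λ')
    {κ'' : Type*} (w : Finset κ'') (a : κ'' → ℂ) (word : κ'' → List (Orb (PolySite Λ') × Bool)) {c : ℝ}
    (hcert : -fermionEmbed (PolySite.incl h0) ((hubbardTTPrimeFermionInteraction t t' U).meanEnergyObs 1) -
        (c : ℂ) • (1 : FermionOp Λ') -
        ∑ σ : Fin 2, ((μ σ : ℝ) : ℂ) • (nAt 0 hz σ - ((ν : ℝ) : ℂ) • (1 : FermionOp Λ')) -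
        ((0 : ℝ) : ℂ) • ((((0 : ℝ) : ℝ) : ℂ) • (1 : FermionOp Λ') -
          fermionEmbed (PolySite.incl h0) ((hubbardTTPrimeFermionInteraction t t' U).meanEnergyObs 1)) =
      gramForm Λm O +
        (∑ k ∈ s, ((hubbardTTPrimeFermionInteraction t t' U).localHamiltonian Λ' * fermionEmbed (PolySite.incl hΛ) (B k) -
            fermionEmbed (PolySite.incl hΛ) (B k) * (hubbardTTPrimeFermionInteraction t t' U).localHamiltonian Λ') +
          ∑ l ∈ tt, (fermionEmbed (PolySite.incl (hsh l)) (fermionEmbed (PolySite.d4Emb (γ l) (wv l) Λ) (Y l)) -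
            fermionEmbed (PolySite.incl hΛ) (Y l)) +
          ∑ j ∈ uu, b j • ladderWord (cw j) +
          ∑ f ∈ ff, (relabel (Orb.spinSwap : Orb (PolySite Λ') ≃ Orb (PolySite Λ')) (Yf f) - Yf f) +
          ∑ z ∈ zz, Nz z) +
        (∑ r ∈ rr, ((lam r : ℝ) : ℂ) •
            (((β : ℝ) : ℂ) • ((fermionEmbed (PolySite.incl hΛ) (A r))ᴴ *
                ((hubbardTTPrimeFermionInteraction t t' U).localHamiltonian Λ' * fermionEmbed (PolySite.incl hΛ) (A r) -
                  fermionEmbed (PolySite.incl hΛ) (A r) * (hubbardTTPrimeFermionInteraction t t' U).localHamiltonian Λ')) -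
              ((sv r : ℝ) : ℂ) • ((fermionEmbed (PolySite.incl hΛ) (A r))ᴴ * fermionEmbed (PolySite.incl hΛ) (A r)) +
              ((qv r : ℝ) : ℂ) • (fermionEmbed (PolySite.incl hΛ) (A r) * (fermionEmbed (PolySite.incl hΛ) (A r))ᴴ)) +
          ∑ e ∈ gg, ((kap e : ℝ) : ℂ) • G e) +
        (∑ m' ∈ ah, ((dc m' : ℝ) : ℂ) • ((V m')ᴴ - V m') + ∑ k ∈ w, a k • ladderWord (word k))) :
    ω.meanEnergy (hubbardTTPrimeFermionInteraction t t' U) 1 ≤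
      ∑ k ∈ w, ‖a k‖ - c -
        min ((∑ σ : Fin 2, μ σ) * (n₁ / 2 - ν)) ((∑ σ : Fin 2, μ σ) * (n₂ / 2 - ν)) := by
  have hmain := h.re_expect_ge_of_thermal_certificate_symm_TT'_of_fillingBox t t' U hn₁ hn₂ β hn hLs hΛ h8
    h0 hz (-fermionEmbed (PolySite.incl h0) ((hubbardTTPrimeFermionInteraction t t' U).meanEnergyObs 1)) 0 0
    μ ν hΛm O s B tt γ wv hsh Y uu b cw hcw ff Yf zz Nz hnull rr lam hlam A hAN hAS sv qv hq gg kap hkap G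
    hG ah dc V w a word hcert
  rw [zero_mul, add_zero, map_neg, Complex.neg_re, ω.re_expect_fermionEmbed_meanEnergyObs _ 1 h0] at hmain
  linarith

/-! ### §3 The four-parameter cell `[tp₁,tp₂] × [U₁,U₂] × [β₁,β₂] × [n₁,n₂]` -/

open scoped Matrix.Norms.L2Operator in
/-- **BOX ⇒ WORD on the cell `[tp₁,tp₂] × [U₁,U₂] × [β₁,β₂] × [n₁,n₂]` for an eom/EEB-class THERMAL
certificate.** Issue ONE full-symmetry thermal window certificate at the anchor `(t, t'_A, U_A, β_A)`
(`U_A ≥ 0`, `κ ≥ 0`; the anchor need not lie in the cell; extra rows split as in `…_transport₃`), and book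
three filling-box constants: a `T = 0` cap AT THE ANCHOR COUPLINGS `e(t,t'_A,U_A,x) ≤ hiA`, an entropy
constant `2H_b(x/2) ≤ S`, for all `x ∈ [n₁,n₂]` (`0 ≤ n₁`, `n₂ < 2`). Then for EVERY
`(t'_P, U_P, β_P, n)` in the cell (`U₁ ≥ 0`, `β₁ > 0`) and EVERY thermal torus limit `ω` there (killing the
generic nulls, nonnegative on the target extra rows):
`c + κ(u − hiA − S/β₁) − Σₖ‖aₖ‖ + min((Σ_σμ_σ)(n₁/2 − ν), (Σ_σμ_σ)(n₂/2 − ν))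
   − max(tp₂ − t'_A, t'_A − tp₁)·(32κ/π² + ‖W_T + X_T‖ + β₂‖V_T‖)
   − max(U₂ − U_A, U_A − U₁)·(κ·min(n₂/2, 1 − n₁/2) + ‖W_D + X_D‖ + β₂‖V_D‖)
   − max(β₂ − β_A, β_A − β₁)·‖V_A + X_β‖ ≤ Re ω_{Λ'}(Xw)`:
the conclusion of `…_transport₃_on_cell` with its three `n`-dependent constants (anchor energy, entropy
re-booking, double-occupancy width) replaced by their box bounds and the density term by its endpoint minimum
— the filling coordinate of the downfold's single-band box joins the `(t', U, T)` cell.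
[cite: FawziFawziScalet2024, Thm. 3.6] [cite: Israel1979, Lemma II.3.1] [cite: KomaTasaki1994, §1]
[cite: Ruelle1969, §3.3] -/
theorem IsTorusLimitOfMixture.re_expect_ge_of_thermal_certificate_symm_TT'_transport₃_on_cell_of_fillingBox
    (t t'A : ℝ) {UA : ℝ} (hUA : 0 ≤ UA) (βA : ℝ) {tp₁ tp₂ U₁ U₂ β₁ β₂ n₁ n₂ : ℝ} (hU₁ : 0 ≤ U₁)
    (hβ₁ : 0 < β₁) (hn₁ : 0 ≤ n₁) (hn₂ : n₂ < 2) {hiA S : ℝ}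
    (hhiA : ∀ x ∈ Set.Icc n₁ n₂, energyDensityTT' t t'A UA x ≤ hiA)
    (hS : ∀ x ∈ Set.Icc n₁ n₂, 2 * Real.binEntropy (x / 2) ≤ S)
    {n : ℝ} (hn : n ∈ Set.Icc n₁ n₂)
    {ω : InfVolFermionState 2} {Ls : ℕ → ℕ} {t'P UP βP : ℝ}
    (htp : t'P ∈ Set.Icc tp₁ tp₂) (hUI : UP ∈ Set.Icc U₁ U₂) (hβI : βP ∈ Set.Icc β₁ β₂)
    (h : ω.IsTorusLimitOfMixture (sectorGibbsCount n) (fun L => sectorGibbsWeightTT' βP t t'P UP n L)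
      (fun L => sectorGibbsVectorTT' t t'P UP n L) Ls)
    (hLs : Tendsto Ls atTop atTop)
    {Λ Λ' : Finset (Site 2)} (hΛ : Λ ⊆ Λ') (h8 : thicken Λ 1 ⊆ Λ')
    (h0 : thicken ({0} : Finset (Site 2)) 1 ⊆ Λ') (hz : (0 : Site 2) ∈ Λ')
    (Xw : FermionOp Λ') {κ : ℝ} (hκ : 0 ≤ κ) (u : ℝ) (μ : Fin 2 → ℝ) (ν : ℝ)
    {m : Type*} [Fintype m] [DecidableEq m] {Λm : Matrix m m ℂ} (hΛm : Λm.PosSemidef)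
    (O : m → FermionOp Λ')
    {κ' : Type*} (s : Finset κ') (B : κ' → FermionOp Λ)
    {ι : Type*} (tt : Finset ι) (γ : ι → DihedralGroup 4) (wv : ι → Site 2)
    (hsh : ∀ l, d4ShiftSet (γ l) (wv l) Λ ⊆ Λ') (Y : ι → FermionOp Λ)
    {ρ : Type*} (uu : Finset ρ) (b : ρ → ℂ) (cw : ρ → List (Orb (PolySite Λ') × Bool))
    (hcw : ∀ j ∈ uu, ladderCharge (cw j) ≠ 0 ∨ ladderSpinCharge (cw j) ≠ 0)
    {φ : Type*} (ff : Finset φ) (Yf : φ → FermionOp Λ')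
    {ζ : Type*} (zz : Finset ζ) (Nz : ζ → FermionOp Λ') (hnull : ∀ z ∈ zz, ω.expect Λ' (Nz z) = 0)
    {θ : Type*} (rr : Finset θ) (lam : θ → ℝ) (hlam : ∀ r ∈ rr, 0 ≤ lam r) (A : θ → FermionOp Λ)
    (hAN : ∀ r ∈ rr, Commute (A r) (totalNumber : FermionOp Λ))
    (hAS : ∀ r ∈ rr, Commute (A r) (HubbardWave0.spinZ : FermionOp Λ))
    (sv qv : θ → ℝ) (hq : ∀ r ∈ rr, Real.exp (sv r - 1) ≤ qv r)
    {η : Type*} (gg : Finset η) (kap : η → ℝ) (hkap : ∀ e ∈ gg, 0 ≤ kap e)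
    (G G₁ GP GT GD GB : η → FermionOp Λ')
    (hGβ : ∀ e ∈ gg, G e = G₁ e + ((βA - βP : ℝ) : ℂ) • GB e)
    (hG₁ : ∀ e ∈ gg, G₁ e = GP e + ((t'A - t'P : ℝ) : ℂ) • GT e + ((UA - UP : ℝ) : ℂ) • GD e)
    (hGP : ∀ e ∈ gg, 0 ≤ (ω.expect Λ' (GP e)).re)
    {δ : Type*} (ah : Finset δ) (dc : δ → ℝ) (V : δ → FermionOp Λ')
    {κ'' : Type*} (w : Finset κ'') (a : κ'' → ℂ) (word : κ'' → List (Orb (PolySite Λ') × Bool)) {c : ℝ}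
    (hcert : Xw - (c : ℂ) • (1 : FermionOp Λ') -
        ∑ σ : Fin 2, ((μ σ : ℝ) : ℂ) • (nAt 0 hz σ - ((ν : ℝ) : ℂ) • (1 : FermionOp Λ')) -
        ((κ : ℝ) : ℂ) • (((u : ℝ) : ℂ) • (1 : FermionOp Λ') -
          fermionEmbed (PolySite.incl h0) ((hubbardTTPrimeFermionInteraction t t'A UA).meanEnergyObs 1)) =
      gramForm Λm O +
        (∑ k ∈ s, ((hubbardTTPrimeFermionInteraction t t'A UA).localHamiltonian Λ' * fermionEmbed (PolySite.incl hΛ) (B k) - fermionEmbed (PolySite.incl hΛ) (B k) * (hubbardTTPrimeFermionInteraction t t'A UA).localHamiltonian Λ') +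
          ∑ l ∈ tt, (fermionEmbed (PolySite.incl (hsh l)) (fermionEmbed (PolySite.d4Emb (γ l) (wv l) Λ) (Y l)) -
            fermionEmbed (PolySite.incl hΛ) (Y l)) +
          ∑ j ∈ uu, b j • ladderWord (cw j) +
          ∑ f ∈ ff, (relabel (Orb.spinSwap : Orb (PolySite Λ') ≃ Orb (PolySite Λ')) (Yf f) - Yf f) +
          ∑ z ∈ zz, Nz z) +
        (∑ r ∈ rr, ((lam r : ℝ) : ℂ) •
            (((βA : ℝ) : ℂ) • ((fermionEmbed (PolySite.incl hΛ) (A r))ᴴ *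
                ((hubbardTTPrimeFermionInteraction t t'A UA).localHamiltonian Λ' * fermionEmbed (PolySite.incl hΛ) (A r) - fermionEmbed (PolySite.incl hΛ) (A r) * (hubbardTTPrimeFermionInteraction t t'A UA).localHamiltonian Λ')) -
              ((sv r : ℝ) : ℂ) • ((fermionEmbed (PolySite.incl hΛ) (A r))ᴴ * fermionEmbed (PolySite.incl hΛ) (A r)) +
              ((qv r : ℝ) : ℂ) • (fermionEmbed (PolySite.incl hΛ) (A r) * (fermionEmbed (PolySite.incl hΛ) (A r))ᴴ)) +
          ∑ e ∈ gg, ((kap e : ℝ) : ℂ) • G e) +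
        (∑ m' ∈ ah, ((dc m' : ℝ) : ℂ) • ((V m')ᴴ - V m') + ∑ k ∈ w, a k • ladderWord (word k))) :
    c + κ * (u - hiA - S / β₁) - ∑ k ∈ w, ‖a k‖ +
        min ((∑ σ : Fin 2, μ σ) * (n₁ / 2 - ν)) ((∑ σ : Fin 2, μ σ) * (n₂ / 2 - ν)) -
        max (tp₂ - t'A) (t'A - tp₁) * (κ * (32 / Real.pi ^ 2) + ‖∑ k ∈ s, ((hubbardTTPrimeFermionInteraction 0 1 0).localHamiltonian Λ' * fermionEmbed (PolySite.incl hΛ) (B k) - fermionEmbed (PolySite.incl hΛ) (B k) * (hubbardTTPrimeFermionInteraction 0 1 0).localHamiltonian Λ') +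
          ∑ e ∈ gg, ((kap e : ℝ) : ℂ) • GT e‖ +
          β₂ * ‖∑ r ∈ rr, ((lam r : ℝ) : ℂ) • ((fermionEmbed (PolySite.incl hΛ) (A r))ᴴ *
                ((hubbardTTPrimeFermionInteraction 0 1 0).localHamiltonian Λ' * fermionEmbed (PolySite.incl hΛ) (A r) - fermionEmbed (PolySite.incl hΛ) (A r) * (hubbardTTPrimeFermionInteraction 0 1 0).localHamiltonian Λ'))‖) -
        max (U₂ - UA) (UA - U₁) * (κ * min (n₂ / 2) (1 - n₁ / 2) + ‖∑ k ∈ s, ((hubbardTTPrimeFermionInteraction 0 0 1).localHamiltonian Λ' * fermionEmbed (PolySite.incl hΛ) (B k) - fermionEmbed (PolySite.incl hΛ) (B k) * (hubbardTTPrimeFermionInteraction 0 0 1).localHamiltonian Λ') +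
          ∑ e ∈ gg, ((kap e : ℝ) : ℂ) • GD e‖ +
          β₂ * ‖∑ r ∈ rr, ((lam r : ℝ) : ℂ) • ((fermionEmbed (PolySite.incl hΛ) (A r))ᴴ *
                ((hubbardTTPrimeFermionInteraction 0 0 1).localHamiltonian Λ' * fermionEmbed (PolySite.incl hΛ) (A r) - fermionEmbed (PolySite.incl hΛ) (A r) * (hubbardTTPrimeFermionInteraction 0 0 1).localHamiltonian Λ'))‖) -
        max (β₂ - βA) (βA - β₁) * ‖∑ r ∈ rr, ((lam r : ℝ) : ℂ) • ((fermionEmbed (PolySite.incl hΛ) (A r))ᴴ *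
                ((hubbardTTPrimeFermionInteraction t t'A UA).localHamiltonian Λ' * fermionEmbed (PolySite.incl hΛ) (A r) - fermionEmbed (PolySite.incl hΛ) (A r) * (hubbardTTPrimeFermionInteraction t t'A UA).localHamiltonian Λ')) +
          ∑ e ∈ gg, ((kap e : ℝ) : ℂ) • GB e‖ ≤
      (ω.expect Λ' Xw).re := by
  have hn0 : 0 ≤ n := hn₁.trans hn.1
  have hn2 : n < 2 := hn.2.trans_lt hn₂
  have hp := h.re_expect_ge_of_thermal_certificate_symm_TT'_transport₃_on_cell t t'A hUA βA hU₁ hβ₁ hn0 hn2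
    htp hUI hβI hLs hΛ h8 h0 hz Xw hκ u μ ν hΛm O s B tt γ wv hsh Y uu b cw hcw ff Yf zz Nz hnull rr lam hlam
    A hAN hAS sv qv hq gg kap hkap G G₁ GP GT GD GB hGβ hG₁ hGP ah dc V w a word hcert
  -- the three filling-box constants
  have hcapA : energyDensityTT' t t'A UA n ≤ hiA := hhiA n hn
  have hent : 2 * Real.binEntropy (n / 2) / β₁ ≤ S / β₁ := div_le_div_of_nonneg_right (hS n hn) hβ₁.le
  have hκA : κ * (u - hiA - S / β₁) ≤
      κ * (u - energyDensityTT' t t'A UA n - 2 * Real.binEntropy (n / 2) / β₁) :=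
    mul_le_mul_of_nonneg_left (by linarith) hκ
  have hmin := min_mul_endpoints_le (M := ∑ σ : Fin 2, μ σ) (ν := ν) hn.1 hn.2
  have hwD : n / 2 - max 0 (n - 1) ≤ min (n₂ / 2) (1 - n₁ / 2) := half_sub_max_le_of_mem_Icc hn.1 hn.2
  have hmaxU : 0 ≤ max (U₂ - UA) (UA - U₁) := by
    rcases le_total UA U₂ with hle | hle
    · exact le_max_of_le_left (sub_nonneg.2 hle)
    · exact le_max_of_le_right (sub_nonneg.2 ((hUI.1.trans hUI.2).trans hle))
  have hDterm : max (U₂ - UA) (UA - U₁) * (κ * (n / 2 - max 0 (n - 1)) + ‖∑ k ∈ s, ((hubbardTTPrimeFermionInteraction 0 0 1).localHamiltonian Λ' * fermionEmbed (PolySite.incl hΛ) (B k) - fermionEmbed (PolySite.incl hΛ) (B k) * (hubbardTTPrimeFermionInteraction 0 0 1).localHamiltonian Λ') +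
          ∑ e ∈ gg, ((kap e : ℝ) : ℂ) • GD e‖ +
          β₂ * ‖∑ r ∈ rr, ((lam r : ℝ) : ℂ) • ((fermionEmbed (PolySite.incl hΛ) (A r))ᴴ *
                ((hubbardTTPrimeFermionInteraction 0 0 1).localHamiltonian Λ' * fermionEmbed (PolySite.incl hΛ) (A r) - fermionEmbed (PolySite.incl hΛ) (A r) * (hubbardTTPrimeFermionInteraction 0 0 1).localHamiltonian Λ'))‖) ≤
      max (U₂ - UA) (UA - U₁) * (κ * min (n₂ / 2) (1 - n₁ / 2) + ‖∑ k ∈ s, ((hubbardTTPrimeFermionInteraction 0 0 1).localHamiltonian Λ' * fermionEmbed (PolySite.incl hΛ) (B k) - fermionEmbed (PolySite.incl hΛ) (B k) * (hubbardTTPrimeFermionInteraction 0 0 1).localHamiltonian Λ') +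
          ∑ e ∈ gg, ((kap e : ℝ) : ℂ) • GD e‖ +
          β₂ * ‖∑ r ∈ rr, ((lam r : ℝ) : ℂ) • ((fermionEmbed (PolySite.incl hΛ) (A r))ᴴ *
                ((hubbardTTPrimeFermionInteraction 0 0 1).localHamiltonian Λ' * fermionEmbed (PolySite.incl hΛ) (A r) - fermionEmbed (PolySite.incl hΛ) (A r) * (hubbardTTPrimeFermionInteraction 0 0 1).localHamiltonian Λ'))‖) :=
    mul_le_mul_of_nonneg_left (by nlinarith [mul_le_mul_of_nonneg_left hwD hκ]) hmaxU
  linarith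

end InfVolFermionState

end Literature.MathematicalPhysics.QuantumLattice

end
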